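import Literature.Analysis.FluidPDE.SawtoothCascadeProfileCurvature
import Summits.AnomalousDissipation.AnomalousDissipation.Theorems.SawtoothPulseCascadeK1LocalisedCascadeAffineProfile

/-!
# K1loc, line `Spectral` / SeqCone — helper: THE CASCADE PROFILE HAS MEAN-ZERO SLOPE CORRECTION (`c = 0` in `Ũ_j`)

Helper file of the prover lane on the crux `K1LocalisedCascade` (stmt-AnomalousDissipation-19491), route
`SawtoothPulseCascade` (memo v6 §2b / addendum §C, S-B "multiplier constants").  `…AffineProfile` affine-izes a shear
profile `U` with slope function `V` as `Ũ = U + ∫₀D − c·id`, `c = ∫₀¹ D`, `D = (1 − V)G⁺ + (−1 − V)G⁻` the slope correction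
of width `δ`, and proves `Ũ′ = ±1 − c` EXACTLY on the deep flats.  The un-gauging bricks (`…SlotMultiplierData`,
`…SymbolCone.compat_H/compat_V`) want the slopes `±1` themselves (the branch shifts are the roundings of `±γn`), i.e. `c = 0`.
For the cascade profile `U_j(y) = S_{δ_j}(2πN_j y)/(2πN_j)` this holds: the triangle wave satisfies `tri(θ + π) = −tri θ`, so
the rounded sawtooth and `U_j` are antisymmetric under the half-period shift, `U_j(y + 1/(2N_j)) = −U_j(y)`
(`U_add_half_period`), hence so is `U_j′` (`deriv_U_add_half_period`); the correction `D` is odd in `V`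
(`slopeCorr_neg`), so `y ↦ D(U_j′(y))` is `1`-periodic and half-period antisymmetric and its mean vanishes
(`intervalIntegral_eq_zero_of_antiperiodic`, `integral_slopeCorr_deriv_U_eq_zero`).  Consequences for the cascade's
affine-ized profile `Ũ_j = U_j + ∫₀ D(U_j′)` (no linear term): slope exactly `1` where `U_j′ ≥ 1 − δ` and `−1` where
`U_j′ ≤ −(1 − δ)`, `1`-periodic, smooth, `Ũ_j′ = U_j′ + D(U_j′)`, `|Ũ_j′ − U_j′| ≤ 2δ`, `|Ũ_j − U_j| ≤ 2δ`
(`hasDerivAt_affinizeU_of_ge/_of_le`, `periodic_affinizeU`, `contDiff_affinizeU`, `hasDerivAt_affinizeU`,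
`abs_deriv_affinizeU_sub_le`, `abs_affinizeU_sub_le`; the last via `abs_intervalIntegral_le_of_mean_zero`).  No definitions; no statement
about the stub.
[cite: ElgindiLissMattingly2025, §1 (the piecewise-linear shears H_α, V_α: slope ±1 strips)] [problem: turb]
-/

-- `Summit.<Summit>.<Problem>`: single-conjunct summit, the duplicate namespace segment is deliberate.
set_option linter.dupNamespace false

noncomputable section

namespace Summit.AnomalousDissipation.AnomalousDissipation.Theorems.SawtoothPulseCascade.K1Cutoff

open Set Filter Topology Real MeasureTheory intervalIntegral
open scoped ContDiff
open Literature.Analysis.FluidPDE.SawtoothCascade Literature.Analysis.FluidPDE.SawtoothCascade.CascadeParams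

/-! ## Half-period antisymmetry of the rounded sawtooth and of the cascade profile -/

/-- `S_δ(θ + π) = −S_δ(θ)`: the Gaussian mollification inherits the antisymmetry `tri(θ + π) = −tri θ` of
`tri = arcsin ∘ sin`. [cite: ElgindiLissMattingly2025, §1 (H_α, V_α)] -/
theorem roundedSaw_add_pi (δ θ : ℝ) : roundedSaw δ (θ + Real.pi) = -roundedSaw δ θ := by
  unfold roundedSaw
  rw [← MeasureTheory.integral_neg]
  refine integral_congr_ae (Filter.Eventually.of_forall fun y => ?_)
  simp only
  rw [show θ + Real.pi - y = θ - y + Real.pi by ring]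
  unfold tri
  rw [Real.sin_add_pi, Real.arcsin_neg, neg_mul]

variable (P : CascadeParams)

/-- **Half-period antisymmetry of the cascade profile**: `U_j(y + 1/(2N_j)) = −U_j(y)` (`N_j ≠ 0`).
[cite: ElgindiLissMattingly2025, §1 (H_α, V_α)] -/
theorem U_add_half_period {j : ℕ} (hN : P.N j ≠ 0) (y : ℝ) : P.U j (y + 1 / (2 * P.N j)) = -P.U j y := by
  have hN' : (P.N j : ℝ) ≠ 0 := Nat.cast_ne_zero.2 hN
  simp only [CascadeParams.U]
  rw [show 2 * Real.pi * (P.N j : ℝ) * (y + 1 / (2 * P.N j)) = 2 * Real.pi * P.N j * y + Real.pi by field_simp,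
    roundedSaw_add_pi, neg_div]

/-- **Half-period antisymmetry of the slope**: `U_j′(y + 1/(2N_j)) = −U_j′(y)` (`N_j ≠ 0`; Mathlib's `deriv`, junk values
included, so no differentiability hypothesis is needed). [cite: ElgindiLissMattingly2025, §1 (H_α, V_α)] -/
theorem deriv_U_add_half_period {j : ℕ} (hN : P.N j ≠ 0) (y : ℝ) :
    deriv (P.U j) (y + 1 / (2 * P.N j)) = -deriv (P.U j) y := by
  have hfun : (fun y => P.U j (y + 1 / (2 * P.N j))) = fun y => -P.U j y := funext fun y => U_add_half_period P hN y
  have h1 : deriv (fun y => P.U j (y + 1 / (2 * P.N j))) y = deriv (P.U j) (y + 1 / (2 * P.N j)) :=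
    deriv_comp_add_const _ _ _
  rw [← h1, hfun]
  exact deriv.neg

/-! ## The slope correction is odd; mean zero by antisymmetry -/

/-- **The slope correction is odd in the slope**: `D(−v) = −D(v)` for
`D(v) = (1 − v)·smoothTransition((v − (1−2δ))/δ) + (−1 − v)·smoothTransition((−v − (1−2δ))/δ)`. [folklore] -/
theorem slopeCorr_neg (δ v : ℝ) :
    (1 - -v) * smoothTransition ((-v - (1 - 2 * δ)) / δ) + (-1 - -v) * smoothTransition ((- -v - (1 - 2 * δ)) / δ) =
      -((1 - v) * smoothTransition ((v - (1 - 2 * δ)) / δ) + (-1 - v) * smoothTransition ((-v - (1 - 2 * δ)) / δ)) := by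
  rw [neg_neg]
  ring

/-- **A `1`-periodic function antisymmetric under some shift has mean zero**: if `f(y + 1) = f(y)` and `f(y + τ) = −f(y)`
for all `y`, then `∫₀¹ f = 0` (`∫₀¹ f = ∫_τ^{τ+1} f = ∫₀¹ f(· + τ) = −∫₀¹ f`). [folklore] -/
theorem intervalIntegral_eq_zero_of_antiperiodic {f : ℝ → ℝ} (hf : Function.Periodic f 1) {τ : ℝ}
    (hτ : ∀ y, f (y + τ) = -f y) : ∫ y in (0 : ℝ)..1, f y = 0 := by
  have h1 : ∫ y in (0 : ℝ)..1, f y = ∫ y in τ..τ + 1, f y := by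
    have := hf.intervalIntegral_add_eq 0 τ
    rwa [zero_add] at this
  have h2 : ∫ y in τ..τ + 1, f y = ∫ y in (0 : ℝ)..1, f (y + τ) := by
    rw [intervalIntegral.integral_comp_add_right (fun y => f y) τ, zero_add, add_comm]
  have h3 : ∫ y in (0 : ℝ)..1, f (y + τ) = -∫ y in (0 : ℝ)..1, f y := by
    simp only [hτ, intervalIntegral.integral_neg]
  linarith [h1.trans (h2.trans h3)]

/-- **The cascade's slope correction has mean zero**: with `V = U_j′` (`N_j ≠ 0`) and any width `δ`,
`∫₀¹ ((1 − V)·smoothTransition((V − (1−2δ))/δ) + (−1 − V)·smoothTransition((−V − (1−2δ))/δ)) = 0` — the constant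
`c` of `…AffineProfile` vanishes for the cascade. [cite: ElgindiLissMattingly2025, §1 (H_α, V_α)] -/
theorem integral_slopeCorr_deriv_U_eq_zero {j : ℕ} (hN : P.N j ≠ 0) (δ : ℝ) :
    ∫ y in (0 : ℝ)..1, ((1 - deriv (P.U j) y) * smoothTransition ((deriv (P.U j) y - (1 - 2 * δ)) / δ) +
      (-1 - deriv (P.U j) y) * smoothTransition ((-deriv (P.U j) y - (1 - 2 * δ)) / δ)) = 0 := by
  refine intervalIntegral_eq_zero_of_antiperiodic (periodic_slopeCorr (P.deriv_U_periodic j) δ) (τ := 1 / (2 * P.N j)) fun y => ?_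
  rw [deriv_U_add_half_period P hN y]
  exact slopeCorr_neg δ _

/-! ## The cascade's affine-ized profile `Ũ_j = U_j + ∫₀ D(U_j′)` (no linear term) -/

/-- **A mean-zero periodic integrand has a uniformly bounded primitive**: if `D` is continuous, `1`-periodic, `∫₀¹ D = 0` and
`|D| ≤ M`, then `|∫₀ʸ D| ≤ M` for every real `y` (the primitive is `1`-periodic; on `[0,1)` it is at most `M·y`). [folklore] -/
theorem abs_intervalIntegral_le_of_mean_zero {D : ℝ → ℝ} (hDp : Function.Periodic D 1) (hDc : Continuous D)
    (h0 : ∫ t in (0 : ℝ)..1, D t = 0) {M : ℝ} (hM : ∀ t, |D t| ≤ M) (y : ℝ) : |∫ t in (0 : ℝ)..y, D t| ≤ M := by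
  have hM0 : 0 ≤ M := (abs_nonneg _).trans (hM 0)
  have hint : ∀ a b : ℝ, IntervalIntegrable D volume a b := fun a b => hDc.intervalIntegrable a b
  have hE : Function.Periodic (fun y => ∫ t in (0 : ℝ)..y, D t) 1 := by
    intro y
    have hsplit : ∫ t in (0 : ℝ)..(y + 1), D t = (∫ t in (0 : ℝ)..y, D t) + ∫ t in y..(y + 1), D t :=
      (integral_add_adjacent_intervals (hint 0 y) (hint y (y + 1))).symm
    have hper : ∫ t in y..(y + 1), D t = ∫ t in (0 : ℝ)..1, D t := by
      have := hDp.intervalIntegral_add_eq y 0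
      rwa [zero_add] at this
    simp only [hsplit, hper, h0, add_zero]
  have hz0 : 0 ≤ Int.fract y := Int.fract_nonneg y
  have hz1 : Int.fract y < 1 := Int.fract_lt_one y
  have hEy : (∫ t in (0 : ℝ)..y, D t) = ∫ t in (0 : ℝ)..(Int.fract y), D t := by
    have hper := (hE.int_mul (Int.floor y)) (Int.fract y)
    simp only [mul_one, Int.fract_add_floor] at hper
    exact hper
  rw [hEy]
  have h := norm_integral_le_of_norm_le_const (a := (0 : ℝ)) (b := Int.fract y) (f := D) (C := M) fun t _ => by
    rw [Real.norm_eq_abs]; exact hM t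
  rw [Real.norm_eq_abs, sub_zero, abs_of_nonneg hz0] at h
  calc |∫ t in (0 : ℝ)..(Int.fract y), D t| ≤ M * Int.fract y := by simpa [mul_comm] using h
    _ ≤ M := by nlinarith

/-- **The cascade's `Ũ_j` is `1`-periodic** (`N_j ≠ 0`, `δ_j > 0`): `∫₀¹ D(U_j′) = 0`, so no linear term is needed.
[cite: ElgindiLissMattingly2025, §1 (H_α, V_α on 𝕋²)] -/
theorem periodic_affinizeU {j : ℕ} (hδj : 0 < P.δ j) (hN : P.N j ≠ 0) (δ : ℝ) :
    Function.Periodic (fun y => P.U j y + ∫ t in (0 : ℝ)..y, ((1 - deriv (P.U j) t) *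
        smoothTransition ((deriv (P.U j) t - (1 - 2 * δ)) / δ) +
      (-1 - deriv (P.U j) t) * smoothTransition ((-deriv (P.U j) t - (1 - 2 * δ)) / δ))) 1 := by
  have h := periodic_affinize (P.U_periodic j) (periodic_slopeCorr (P.deriv_U_periodic j) δ)
    (contDiff_slopeCorr (P.contDiff_deriv_U hδj) δ).continuous
  rw [integral_slopeCorr_deriv_U_eq_zero P hN δ] at h
  simpa only [zero_mul, sub_zero] using h

/-- **The cascade's `Ũ_j` is smooth** (`δ_j > 0`, `N_j ≠ 0`). [cite: ElgindiLissMattingly2025, §1 and Rmk. 1.4 (smoothed profiles)] -/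
theorem contDiff_affinizeU {j : ℕ} (hδj : 0 < P.δ j) (hN : P.N j ≠ 0) (δ : ℝ) :
    ContDiff ℝ ∞ (fun y => P.U j y + ∫ t in (0 : ℝ)..y, ((1 - deriv (P.U j) t) *
        smoothTransition ((deriv (P.U j) t - (1 - 2 * δ)) / δ) +
      (-1 - deriv (P.U j) t) * smoothTransition ((-deriv (P.U j) t - (1 - 2 * δ)) / δ))) := by
  have hUV : ∀ y, HasDerivAt (P.U j) (deriv (P.U j) y) y := fun y => (P.hasDerivAt_U hδj hN y).differentiableAt.hasDerivAt
  have h := contDiff_affinize hUV (P.contDiff_deriv_U hδj) (contDiff_slopeCorr (P.contDiff_deriv_U hδj) δ) 0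
  simpa only [zero_mul, sub_zero] using h

/-- **The slope of `Ũ_j` is `U_j′ + D(U_j′)`** (pointwise `HasDerivAt`; `δ_j > 0`, `N_j ≠ 0`).
[cite: ElgindiLissMattingly2025, §1 (H_α, V_α)] -/
theorem hasDerivAt_affinizeU {j : ℕ} (hδj : 0 < P.δ j) (hN : P.N j ≠ 0) (δ y : ℝ) :
    HasDerivAt (fun y => P.U j y + ∫ t in (0 : ℝ)..y, ((1 - deriv (P.U j) t) *
        smoothTransition ((deriv (P.U j) t - (1 - 2 * δ)) / δ) +
      (-1 - deriv (P.U j) t) * smoothTransition ((-deriv (P.U j) t - (1 - 2 * δ)) / δ)))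
      (deriv (P.U j) y + ((1 - deriv (P.U j) y) * smoothTransition ((deriv (P.U j) y - (1 - 2 * δ)) / δ) +
        (-1 - deriv (P.U j) y) * smoothTransition ((-deriv (P.U j) y - (1 - 2 * δ)) / δ))) y := by
  have hUV : ∀ y, HasDerivAt (P.U j) (deriv (P.U j) y) y := fun y => (P.hasDerivAt_U hδj hN y).differentiableAt.hasDerivAt
  have h := hasDerivAt_affinize hUV (contDiff_slopeCorr (P.contDiff_deriv_U hδj) δ).continuous 0 y
  simpa only [zero_mul, sub_zero] using h

/-- **`Ũ_j′` stays `2δ`-close to `U_j′`** (`0 < δ ≤ 1/2`, `δ_j > 0`, `N_j ≠ 0`): `Ũ_j′ − U_j′ = D(U_j′)` and `|D| ≤ 2δ`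
since `|U_j′| ≤ 1`. [cite: ElgindiLissMattingly2025, §1 (H_α, V_α have slope ±1)] -/
theorem abs_deriv_affinizeU_sub_le {δ : ℝ} (hδ : 0 < δ) (hδ2 : δ ≤ 1 / 2) {j : ℕ} (hδj : 0 < P.δ j) (hN : P.N j ≠ 0)
    (y : ℝ) :
    |deriv (fun y => P.U j y + ∫ t in (0 : ℝ)..y, ((1 - deriv (P.U j) t) *
        smoothTransition ((deriv (P.U j) t - (1 - 2 * δ)) / δ) +
      (-1 - deriv (P.U j) t) * smoothTransition ((-deriv (P.U j) t - (1 - 2 * δ)) / δ))) y - deriv (P.U j) y| ≤ 2 * δ := by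
  rw [(hasDerivAt_affinizeU P hδj hN δ y).deriv, add_sub_cancel_left]
  exact abs_slopeCorr_le hδ hδ2 (fun y => P.abs_deriv_U_le_one hδj y) y

/-- **`Ũ_j` stays `2δ`-close to `U_j`** (`0 < δ ≤ 1/2`, `δ_j > 0`, `N_j ≠ 0`): `Ũ_j − U_j = ∫₀ʸ D(U_j′)` is `1`-periodic
(mean zero) and `|D| ≤ 2δ`. [cite: ElgindiLissMattingly2025, §1 (H_α, V_α)] -/
theorem abs_affinizeU_sub_le {δ : ℝ} (hδ : 0 < δ) (hδ2 : δ ≤ 1 / 2) {j : ℕ} (hδj : 0 < P.δ j) (hN : P.N j ≠ 0)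
    (y : ℝ) :
    |(P.U j y + ∫ t in (0 : ℝ)..y, ((1 - deriv (P.U j) t) *
        smoothTransition ((deriv (P.U j) t - (1 - 2 * δ)) / δ) +
      (-1 - deriv (P.U j) t) * smoothTransition ((-deriv (P.U j) t - (1 - 2 * δ)) / δ))) - P.U j y| ≤ 2 * δ := by
  rw [add_sub_cancel_left]
  exact abs_intervalIntegral_le_of_mean_zero (periodic_slopeCorr (P.deriv_U_periodic j) δ)
    (contDiff_slopeCorr (P.contDiff_deriv_U hδj) δ).continuous (integral_slopeCorr_deriv_U_eq_zero P hN δ)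
    (fun t => abs_slopeCorr_le hδ hδ2 (fun y => P.abs_deriv_U_le_one hδj y) t) y

/-- **Exact slope `+1` on the deep `+` flats**: for `0 < δ ≤ 2/3`, `δ_j > 0`, `N_j ≠ 0` and `U_j′(y) ≥ 1 − δ`,
`Ũ_j = U_j + ∫₀ D(U_j′)` has derivative EXACTLY `1` at `y`. [cite: ElgindiLissMattingly2025, §1 (slope +1 strips)] -/
theorem hasDerivAt_affinizeU_of_ge {δ : ℝ} (hδ : 0 < δ) (hδ1 : δ ≤ 2 / 3) {j : ℕ} (hδj : 0 < P.δ j) (hN : P.N j ≠ 0)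
    {y : ℝ} (hy : 1 - δ ≤ deriv (P.U j) y) :
    HasDerivAt (fun y => P.U j y + ∫ t in (0 : ℝ)..y, ((1 - deriv (P.U j) t) *
        smoothTransition ((deriv (P.U j) t - (1 - 2 * δ)) / δ) +
      (-1 - deriv (P.U j) t) * smoothTransition ((-deriv (P.U j) t - (1 - 2 * δ)) / δ))) 1 y := by
  have hUV : ∀ y, HasDerivAt (P.U j) (deriv (P.U j) y) y := fun y => (P.hasDerivAt_U hδj hN y).differentiableAt.hasDerivAt
  have hVc : Continuous (deriv (P.U j)) := (P.contDiff_deriv_U hδj (n := 0)).continuous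
  have h := hasDerivAt_affinize_of_ge hδ hδ1 hUV hVc 0 hy
  simp only [zero_mul, sub_zero] at h
  exact h

/-- **Exact slope `−1` on the deep `−` flats**: for `0 < δ ≤ 2/3`, `δ_j > 0`, `N_j ≠ 0` and `U_j′(y) ≤ −(1 − δ)`,
`Ũ_j = U_j + ∫₀ D(U_j′)` has derivative EXACTLY `−1` at `y`. [cite: ElgindiLissMattingly2025, §1 (slope −1 strips)] -/
theorem hasDerivAt_affinizeU_of_le {δ : ℝ} (hδ : 0 < δ) (hδ1 : δ ≤ 2 / 3) {j : ℕ} (hδj : 0 < P.δ j) (hN : P.N j ≠ 0)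
    {y : ℝ} (hy : deriv (P.U j) y ≤ -(1 - δ)) :
    HasDerivAt (fun y => P.U j y + ∫ t in (0 : ℝ)..y, ((1 - deriv (P.U j) t) *
        smoothTransition ((deriv (P.U j) t - (1 - 2 * δ)) / δ) +
      (-1 - deriv (P.U j) t) * smoothTransition ((-deriv (P.U j) t - (1 - 2 * δ)) / δ))) (-1) y := by
  have hUV : ∀ y, HasDerivAt (P.U j) (deriv (P.U j) y) y := fun y => (P.hasDerivAt_U hδj hN y).differentiableAt.hasDerivAt
  have hVc : Continuous (deriv (P.U j)) := (P.contDiff_deriv_U hδj (n := 0)).continuous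
  have h := hasDerivAt_affinize_of_le hδ hδ1 hUV hVc 0 hy
  simp only [zero_mul, sub_zero] at h
  exact h

end Summit.AnomalousDissipation.AnomalousDissipation.Theorems.SawtoothPulseCascade.K1Cutoff
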